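import Summits.BirchSwinnertonDyer.BirchSwinnertonDyer.Theorems.EisensteinPrimesIndexPlumbingLambdaLE
import Literature.NumberTheory.IwasawaTheory.Greenberg2016.SelmerGroupStructure
import Literature.NumberTheory.IwasawaTheory.Greenberg2016.GlobalToLocalSurjectivity
import Literature.NumberTheory.IwasawaTheory.Greenberg2006.GaloisCohomologyStructure
import Literature.NumberTheory.EllipticCurves.BCGKPST2020.SplitTwoVariableMainConjecture
import Literature.NumberTheory.EllipticCurves.HeegnerPoints
import Literature.NumberTheory.EllipticCurves.Rank1Residual.Predicates
import HarnessLib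

/-!
# Route `EisensteinPrimes`, crux 2 `GoodLatticeBDPValue` (stmt-BirchSwinnertonDyer-19032), line `halves` v20.1:
# **registered stub `stub_indexPlumbing` (Stub 2a-II, THE PLUMBING OF THE V21 INDEX ROAD) — CLOSED BY NAME**

Cell `bsd-eis` (home `run/shared/lean/pub/bsd-eis/`), width seat `bsd-line-x1-p1-w8` («width 8»). STUB MODE: the statement
below is the registered stub `stub_indexPlumbing` of `Cruxes/GoodLatticeBDPValue/Lines/halves.lean` v20.1 (LEAD
`bsd-line-x1-p1` g4: v20 a012386a… with the conclusion weakened from `=` to `≤`, STATUS 2026-08-28T16:57:00Z), binders and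
antecedents VERBATIM; the proof is ONE call to `IndexPlumbingNrVsStrict.lambdaInvariant_add_le_of_mid` (p651468), which
assembles (C) `λ(𝔛^{Sf}_f) = zpCorank R(E_K[p^∞])` (w5, p648073), (B2) `λ(DSsub.X) = zpCorank R((F/𝒪)(θsub))` (p651097) and
(B1) `λ(DSquot.X) ≤ zpCorank R((F/𝒪)(θquot)) + p^c` (p649735/p650472) over the mid-level identity `hmid`. The nine published
antecedents, `hτ`, `hdist`, the strict-condition reductions for the other two modules and the two SUR clauses of the stub are
not needed for the `≤` direction and are ignored.

HONEST FRAMING: 0 definitions, 0 named facts, 0 sorry; no `Theses`/`Cruxes` import. This closes the registered KERNEL stub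
2a-II of line `halves` ONLY (its hypotheses include the mid-level identity, i.e. the output of stub 2a-I `stub_indexInputs` +
`ResidualIndexAssembly`); crux 2, stub 2a-I, the three PUB bundles and the PRE stub `stub_anThreeTrivial` stay as they are;
no summit statement, no BSD / IMC2 / KY Thm. 1.4.1 (iii) for any curve is proved by this file. References: [KellerYin2024]
Thm. 1.4.1 (iii), §1.4 (arXiv:2402.12781v2 TeX L1087–1098, L1240–1260); [Greenberg1989] §4; the road memo
`Cruxes/GoodLatticeBDPValue/Lines/halves-imprimLambda-index-road.md` §2 (7)–(9).
-/

set_option linter.dupNamespace false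
set_option autoImplicit false

noncomputable section

namespace Summit.BirchSwinnertonDyer.BirchSwinnertonDyer.Theorems.IndexPlumbingNrVsStrict

open scoped Classical

open PowerSeries WeierstrassCurve NumberField IsDedekindDomain Field
  Literature.NumberTheory.GaloisRepresentations Literature.NumberTheory.EllipticCurves.GreenbergVatsal2000
  Literature.NumberTheory.EllipticCurves Literature.NumberTheory.EllipticCurves.ModularForms
  Literature.NumberTheory.EllipticCurves.Rank1Residual Literature.NumberTheory.EllipticCurves.Castella2018
  Literature.NumberTheory.EllipticCurves.GreenbergSelmer Literature.NumberTheory.QuadraticFields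
  Literature.NumberTheory.EllipticCurves.CastellaGrossiLeeSkinner2022
  Literature.NumberTheory.EllipticCurves.KellerYin2024 Literature.NumberTheory.EllipticCurves.IwasawaAlgebra
  Literature.NumberTheory.EllipticCurves.BCGKPST2020
open Literature.NumberTheory.IwasawaTheory Literature.NumberTheory.IwasawaTheory.Greenberg2016
  Literature.NumberTheory.IwasawaTheory.Greenberg2006
open Summit.BirchSwinnertonDyer.Rank1Residual.X2.ResidualDevissageModules

/-- **Stub 2a-II (v20.1) — THE PLUMBING OF THE V21 INDEX ROAD, CLOSED** (registered statement of
`Cruxes/GoodLatticeBDPValue/Lines/halves.lean`, `stub_indexPlumbing`, VERBATIM): at the data of KY Thm. 1.4.1, the conclusion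
of the mid-level composition — `corank R(E[p^∞]) + ε = corank R((F/𝒪)(θsub)) + corank R((F/𝒪)(θquot)) + p^c` for the STRICT
residual-type Selmer groups over `K_∞ = K̄^{ker κ}`, `p^c = #{places of K_∞ above v̄}` — implies the `λ`-inequality of Thm.
1.4.1 (iii) for the dual data, `λ(DSsub.X) + λ(DSquot.X) ≤ λ(𝔛^{Sf}_f) + ε`, GIVEN the cotorsion / `μ = 0` facts (then
`λ = corank_{ℤ_p}`): (B) non-primitive vs strict at `v̄` (`+p^c` for `θquot`, `+0` for `θsub`), (C) the dictionaries. Proof: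
`IndexPlumbingNrVsStrict.lambdaInvariant_add_le_of_mid`. [cite: KellerYin2024, Thm. 1.4.1 (iii) (arXiv:2402.12781v2 TeX L1087–1098), §1.4 (L1240–1260), Rem. 1.2.2]
[cite: Greenberg1989, §4] -/
theorem stub_indexPlumbing :
    prop411_selmer_isAlmostDivisible → prop422_localCohomology_isAlmostDivisible →
    sec5A_localH2_subsingleton_of_LOC1 → prop41_globalEulerPoincareCorank → prop42_localEulerPoincareCorank →
    prop32_cohomology_isCofinitelyGenerated → BCGKPST2020.sec33_rubin_unrSelmer₂_finite_torsion →
    weakLeopoldt_H2_subsingleton_above_cyclotomic_of_isOpen → prop263_sur_of_crk →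
    ∀ (W : WeierstrassCurve ℚ) [W.IsElliptic] [W.IsGloballyMinimal] (p : ℕ) [Fact p.Prime],
      2 < p → Good W p → Red W p → Anom W p →
      (∀ Φ : AddSubgroup (geomTorsion W (p : ℤ)), IsRationalLine W p Φ → ¬ LineUnramifiedAt W p Φ) →
      ∀ (K : Type) [Field K] [NumberField K], IsImaginaryQuadratic K →
        SatisfiesHeegnerHypothesis (W.conductorNorm ℤ) K → SatisfiesHeegnerHypothesis p K →
        (∀ Q : (W.baseChange K).toAffine.Point, p • Q = 0 → Q = 0) →
      ∀ (ι : K →+* ℚ_[p]) (v vbar : HeightOneSpectrum (𝓞 K)),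
        (∀ x : 𝓞 K, x ∈ v.asIdeal ↔ ‖ι (x : K)‖ < 1) →
        ((p : ℕ) : 𝓞 K) ∈ vbar.asIdeal → vbar ≠ v →
      ∀ (κ : ZpExtension K p), κ.IsAnticyclotomic →
      ∀ (γ : absoluteGaloisGroup K) [Fact (κ.IsTopGenerator γ)],
      ∀ (θsub θquot : FramedGaloisRep K (padicCoeffIntegers (∅ : Set (PadicAlgCl p))) 1),
        IsResidualPairOver (W.baseChange K) p θsub θquot →
      ∀ (Sf : Finset (HeightOneSpectrum (𝓞 K))),
        (∀ w : HeightOneSpectrum (𝓞 K), w ∈ Sf ↔ ((W.conductorNorm ℤ : ℤ) : 𝓞 K) ∈ w.asIdeal) →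
      ∀ (DSsub : DatumDualData κ γ (charModule ∅ θsub)
          (AcSelmer.bdpData (charModule ∅ θsub) p vbar) (↑Sf : Set (HeightOneSpectrum (𝓞 K))))
        (DSquot : DatumDualData κ γ (charModule ∅ θquot)
          (AcSelmer.bdpData (charModule ∅ θquot) p vbar) (↑Sf : Set (HeightOneSpectrum (𝓞 K)))),
      ∀ (c : ℕ) (τ : ℕ → absoluteGaloisGroup K),
        (∀ i : ℕ, κ (τ i) = Multiplicative.ofAdd ((i : ℕ) : ℤ_[p])) →
        (∀ i j : ℕ, i < p ^ c → j < p ^ c → i ≠ j → ∀ δ ∈ decomp vbar,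
          Multiplicative.ofAdd ((j : ℕ) : ℤ_[p]) ≠ Multiplicative.ofAdd ((i : ℕ) : ℤ_[p]) * κ δ) →
        (∀ x : subgroupH1 κ.kerSubgroup (charModule ∅ θsub),
          (∀ i, i < p ^ c → resOfLe (charModule ∅ θsub) (inf_le_left : κ.kerSubgroup ⊓ decomp vbar ≤ κ.kerSubgroup) (conjH1 κ.kerSubgroup (charModule ∅ θsub) (τ i) x) = 0) →
            ∀ σ : absoluteGaloisGroup K, resOfLe (charModule ∅ θsub) (inf_le_left : κ.kerSubgroup ⊓ decomp vbar ≤ κ.kerSubgroup) (conjH1 κ.kerSubgroup (charModule ∅ θsub) σ x) = 0) →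
        (∀ x : subgroupH1 κ.kerSubgroup ↥((W.baseChange K).geomPrimaryTorsion p),
          (∀ i, i < p ^ c → resOfLe ↥((W.baseChange K).geomPrimaryTorsion p) (inf_le_left : κ.kerSubgroup ⊓ decomp vbar ≤ κ.kerSubgroup) (conjH1 κ.kerSubgroup ↥((W.baseChange K).geomPrimaryTorsion p) (τ i) x) = 0) →
            ∀ σ : absoluteGaloisGroup K, resOfLe ↥((W.baseChange K).geomPrimaryTorsion p) (inf_le_left : κ.kerSubgroup ⊓ decomp vbar ≤ κ.kerSubgroup) (conjH1 κ.kerSubgroup ↥((W.baseChange K).geomPrimaryTorsion p) σ x) = 0) →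
        (∀ x : subgroupH1 κ.kerSubgroup (charModule ∅ θquot),
          (∀ i, i < p ^ c → resOfLe (charModule ∅ θquot) (inf_le_left : κ.kerSubgroup ⊓ decomp vbar ≤ κ.kerSubgroup) (conjH1 κ.kerSubgroup (charModule ∅ θquot) (τ i) x) = 0) →
            ∀ σ : absoluteGaloisGroup K, resOfLe (charModule ∅ θquot) (inf_le_left : κ.kerSubgroup ⊓ decomp vbar ≤ κ.kerSubgroup) (conjH1 κ.kerSubgroup (charModule ∅ θquot) σ x) = 0) →
        (∀ y : Fin (p ^ c) → subgroupH1 (κ.kerSubgroup ⊓ decomp vbar) (charModule ∅ θsub), ∃ u ∈ unramifiedOutside κ.kerSubgroup (charModule ∅ θsub) p (↑Sf : Set (HeightOneSpectrum (𝓞 K))),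
          ∀ i : Fin (p ^ c), resOfLe (charModule ∅ θsub) (inf_le_left : κ.kerSubgroup ⊓ decomp vbar ≤ κ.kerSubgroup) (conjH1 κ.kerSubgroup (charModule ∅ θsub) (τ i) u) = y i) →
        (∀ y : Fin (p ^ c) → subgroupH1 (κ.kerSubgroup ⊓ decomp vbar) (charModule ∅ θquot), ∃ u ∈ unramifiedOutside κ.kerSubgroup (charModule ∅ θquot) p (↑Sf : Set (HeightOneSpectrum (𝓞 K))),
          ∀ i : Fin (p ^ c), resOfLe (charModule ∅ θquot) (inf_le_left : κ.kerSubgroup ⊓ decomp vbar ≤ κ.kerSubgroup) (conjH1 κ.kerSubgroup (charModule ∅ θquot) (τ i) u) = y i) →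
        zpCorank (datumStrictSelmer κ.kerSubgroup ↥((W.baseChange K).geomPrimaryTorsion p) p (AcSelmer.bdpData ↥((W.baseChange K).geomPrimaryTorsion p) p vbar) (↑Sf : Set (HeightOneSpectrum (𝓞 K)))) p + (if ∀ σ : absoluteGaloisGroup K, θquot σ = 1 then 1 else 0) =
          zpCorank (datumStrictSelmer κ.kerSubgroup (charModule ∅ θsub) p (AcSelmer.bdpData (charModule ∅ θsub) p vbar) (↑Sf : Set (HeightOneSpectrum (𝓞 K)))) p + zpCorank (datumStrictSelmer κ.kerSubgroup (charModule ∅ θquot) p (AcSelmer.bdpData (charModule ∅ θquot) p vbar) (↑Sf : Set (HeightOneSpectrum (𝓞 K)))) p + p ^ c →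
      Module.Finite (IwasawaAlgebra p) (AcSelmer.XAc (W.baseChange K) p κ vbar (↑Sf : Set (HeightOneSpectrum (𝓞 K))) γ) →
      Module.IsTorsion (IwasawaAlgebra p) (AcSelmer.XAc (W.baseChange K) p κ vbar (↑Sf : Set (HeightOneSpectrum (𝓞 K))) γ) →
      muInvariant p (AcSelmer.XAc (W.baseChange K) p κ vbar (↑Sf : Set (HeightOneSpectrum (𝓞 K))) γ) = 0 →
      (∀ D : DatumDualData κ γ (charModule ∅ θsub)
          (AcSelmer.bdpData (charModule ∅ θsub) p vbar) (↑Sf : Set (HeightOneSpectrum (𝓞 K))),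
        Module.Finite (IwasawaAlgebra p) D.X ∧ Module.IsTorsion (IwasawaAlgebra p) D.X ∧ muInvariant p D.X = 0) →
      (∀ D : DatumDualData κ γ (charModule ∅ θquot)
          (AcSelmer.bdpData (charModule ∅ θquot) p vbar) (↑Sf : Set (HeightOneSpectrum (𝓞 K))),
        Module.Finite (IwasawaAlgebra p) D.X ∧ Module.IsTorsion (IwasawaAlgebra p) D.X ∧ muInvariant p D.X = 0) →
      lambdaInvariant p DSsub.X + lambdaInvariant p DSquot.X ≤
        lambdaInvariant p (AcSelmer.XAc (W.baseChange K) p κ vbar (↑Sf : Set (HeightOneSpectrum (𝓞 K))) γ) +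
          (if ∀ σ : absoluteGaloisGroup K, θquot σ = 1 then 1 else 0) := by
  intro _ _ _ _ _ _ _ _ _ W _ _ p _ hp _ _ hanom hlat K _ _ hK _ _ _ ι v vbar hv hvbar hne κ hκ γ _ θsub θquot hpair
    Sf hSf DSsub DSquot c τ _ _ _ _ hreps₃ _ _ hmid hfgS htorS hμS hSsub hSquot
  haveI := hfgS
  exact lambdaInvariant_add_le_of_mid W p hp hanom hlat K hK ι v vbar hv hvbar hne κ hκ γ θsub θquot hpair Sf hSf
    DSsub DSquot c τ hreps₃ hmid htorS hμS hSsub hSquot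

end Summit.BirchSwinnertonDyer.BirchSwinnertonDyer.Theorems.IndexPlumbingNrVsStrict

end
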